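import Summits.BirchSwinnertonDyer.BirchSwinnertonDyer.Theorems.KimAtThreeD7uTamagawaKuriharaDeep
import Summits.BirchSwinnertonDyer.BirchSwinnertonDyer.Theorems.KimAtThreeD7uTamagawaDefectExponentLe
import Summits.BirchSwinnertonDyer.Rank1Residual.GaloisImage.KuriharaLowerBoundThreeOfKolyvaginProductCyclic
import Summits.BirchSwinnertonDyer.Rank1Residual.GaloisImage.FrobeniusClassIndependence
import HarnessLib

/-!
# The TAMAGAWA-DIVISIBLE bad places, XXIII-le: «TamDiv∞» in KURIHARA-NUMBER currency — the DEEP bound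
# `k + 1 ≤ v₃(c_ℓ) ⇒ (k + 1 : ℕ∞) ≤ ∂^{(∞)}_{deep}(δ̃)` modulo a displayed `𝓕_u`-witness at every depth,
# CONSUMER FORM (canonical data asked for the levels `j ≤ m` only — see `KimAtThreeD7uTamagawaDefectExponentLe`)
# (cell `bsd-addord`, seat w2-tamdiv gen 7; route W2 `KimAtThreeKolyvagin`, items 19679 / 19562 / 19599 (TD),
# 19560)

HONEST FRAMING: TOOL theorems (no definition, no named fact, no `sorry`); closes nothing by itself;
nothing is booked; BSD is not proved by any of this.  CONDITIONAL on (a) part XV's displayed binders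
(Poitou–Tate family `inv` at `3`, Tate's local Euler–Poincaré characteristic `hEP`, no `Γ_ℚ`-fixed
points on the `E[3^j·3]`, the (H.2)-cokernels of ONE `τ`, Kolyvagin data `D j` on ONE prime set — here
PINNED to Sakamoto's class of `τ` through `E[3^m·3]` — canonical and admissible FOR `j ≤ m` (the bounded,
satisfiable form: part XXIII asked this for every `j`, which no curve satisfies — see the module docstring of
`KimAtThreeD7uTamagawaDefectExponentLe`), with ONE `η`, the level-one prime choice `hprime`), (b) the `3`-adic tower, and (c) THE DISPLAYED PORT: at every depth `k ≤ m` a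
PORT″ witness `GaloisImage.KatoKuriharaWitnessAt W k 0 (D k) v₃ P₀ κ Λ κ'` (cell n1011's typed
Kato–Kurihara dictionary, flag `K22-Thm3.13-PORT@3`) whose Kolyvagin system `κ'` lies in
`KS(E[3^k·3], 𝓕_u, D k)` for [MR04] Remark A.5's unramified structure `𝓕_u` — the structure into
which a Kato-type Euler system of `T₃E` maps (seat gen 2,
`KimAtThreeD7uKolyvaginPairBlochKato.exists_isKolyvaginSystem_pair_blochKatoSelmerStructure_of_unramified_odd`);
n1011's dischargers ★PK-6₂ (`katoKuriharaPortThreeAtWith₂_zero_of_zetaBody`) produce the same witness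
with `κ' = κ ∈ KS(𝓕_can)` from Kato's `ZetaBody`.  Nothing here instantiates (c).

## What

* §1 `kuriharaNumber_eq_zero_of_witnessAt_blochKatoRelaxed_of_pow_succ_dvd_le` — part XXII §4 over part
  XV-le (canonical data for `j ≤ k` only).
* §2 **`natCast_le_kuriharaPartialDeepInfty_of_witnesses_of_pow_succ_dvd_le`** (`p = 3`): for `W/ℚ` with
  the `3`-adic tower onto and **`3^{m+1} ∣ c_ℓ`** at ONE finite `ℓ ∤ 3` (every reduction type at `ℓ`),
  GRANTED (a)–(c): **`(m + 1 : ℕ∞) ≤ kuriharaPartialDeepInfty W 3 P₀.f`** — every Kurihara number of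
  `P₀.f` at every cyclic level `n ∈ 𝒩_{m+1}(E,3)` is divisible by `3^{m+1}`.  Proof: the places of `n`
  form a level of the pinned datum (n1011 bridge (B1) `FrobShape.exists_level_of_kolyvaginProduct`:
  Kolyvagin primes with the cyclicity flag lie in Sakamoto's class of `τ`, `ρ_{E,3^{m+1}}` onto); the
  class through `E[3^m·3]` lies in the class through `E[3^k·3]` for `k ≤ m`
  (`FrobShape.frobeniusClassPrimes_pow_mul_subset_of_le`), so part XV applies at every depth `k ≤ m`
  (`3^{k+1} ∣ 3^{m+1} ∣ c_ℓ`) and part XXII §4 gives `δ̃^{(k+1)}_n = 0`; part XXII §1/§3 turn these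
  vanishings into the deep bound.
* §3 `natCast_padicValNat_le_kuriharaPartialDeepInfty_of_witnesses_le` — the same with the
  exponent read as `v₃(c_ℓ)`: **`(v₃(c_ℓ) : ℕ∞) ≤ ∂^{(∞)}_{deep}(δ̃)`** (for `3 ∣ c_ℓ`), i.e. the route's
  (TD) binder `hTD` of `KimAtThreeDeepLowerOffStratumCornerKeysSharp.stub_nonAdditive_…_of_tamagawa_le_deepInfty`
  ON THE ROWS WITH ONE TAMAGAWA-`3` PRIME (`v₃(∏ c_ℓ) = v₃(c_ℓ)`), modulo (a)–(c).  Rows with two or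
  more Tamagawa-`3` primes: the product exponent `v₃(∏ c_ℓ)` is Kim 2025 Conj. 7.1 / Büyükboduk 2009
  §4.2 Q1 and is NOT obtainable from Kolyvagin systems for `𝓕_u` (part XVII's exact threshold
  `max_ℓ v₃(c_ℓ)`).

References: K. Büyükboduk, JNT 129 (2009) Thm. 3.1, Cor. 3.3, §4.2; B. Mazur, K. Rubin, Mem. AMS 799
(2004) Def. 4.5.7, 5.2.11, Thm. 5.2.12 (i), Prop. 6.2.6, App. A Remark A.5; C.-H. Kim, AJM 148 (2026)
§1.2.2, §1.4.3, §1.5.1, Thm. 3.13, Conj. 1.10; R. Sakamoto, JTNB 36 (2024) §2, Def. 4.1.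
-/

noncomputable section

-- the cell's Theorems namespace `Summit.BirchSwinnertonDyer.BirchSwinnertonDyer.…` repeats the summit name by design (D-0017)
set_option linter.dupNamespace false

open scoped Classical NumberField ContRepresentation
open Function Field NumberField IsDedekindDomain WeierstrassCurve
  Literature.NumberTheory.EllipticCurves Literature.NumberTheory.EllipticCurves.ModularForms
  Literature.NumberTheory.GaloisRepresentations
  Literature.NumberTheory.GaloisRepresentations.DiscreteGaloisModule Literature.NumberTheory.GaloisCohomology
open Summit.BirchSwinnertonDyer.Rank1Residual.GaloisImage
open Summit.BirchSwinnertonDyer.Rank1Residual.GaloisImage.Assembly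
open Summit.BirchSwinnertonDyer.BirchSwinnertonDyer.Theorems.KimAtThreeD7uTamagawaKurihara
open Summit.BirchSwinnertonDyer.BirchSwinnertonDyer.Theorems.KimAtThreeD7uTamagawaKuriharaDeep
open Summit.BirchSwinnertonDyer.BirchSwinnertonDyer.Theorems.KimAtThreeD7uTamagawaDefectDevissage

namespace Summit.BirchSwinnertonDyer.BirchSwinnertonDyer.Theorems.KimAtThreeD7uTamagawaKuriharaDeepLe

/-! ### §1 Depth `k`, consumer form: `3^{k+1} ∣ c_ℓ` and a `𝓕_u`-witness ⇒ `δ̃^{(k+1)}_{n(d)} = 0` -/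

section Three

variable (W : WeierstrassCurve ℚ) [W.IsElliptic] [W.IsGloballyMinimal]

/-- **«TamDiv∞» in Kurihara currency at depth `k`, `t = 0`, CONSUMER FORM** — part XV-le composed with part
XXII §2: on the binders of part XV-le (the canonical data asked for `j ≤ k` ONLY; otherwise VERBATIM: Poitou–Tate family `inv` at `3`, Tate's `hEP`, `T ⊇ {3} ∪ bad`, a finite
`ℓ ∤ 3` with **`3^{k+1} ∣ c_ℓ`**, no `Γ_ℚ`-fixed points, the (H.2)-cokernels of `τ`, canonical admissible
data `D j` on ONE prime set `P ⊆` the `τ`-class at level `3^{k+1}` with ONE `η`, the level-one prime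
choice `hprime`) and a PORT″ witness `KatoKuriharaWitnessAt W k 0 (D k) v₃ P₀ κ Λ κ'` whose Kolyvagin
system `κ'` lies in `KS(E[3^k·3], 𝓕_u, D k)` for [MR04] Remark A.5's `𝓕_u` (the structure a Kato-type
Euler system maps to, seat gen 2): **every level `d` of `D k` has `δ̃^{(k+1)}_{n(d)} = 0`** (for a
surjective system of discrete logarithms; hence for all).  The module `KS(E[3^k·3], 𝓕_u, D k)` is `⊥`
by part XV, so §2 applies.  Büyükboduk 2009 Thm. 3.1 / Cor. 3.3 read on Kurihara numbers through Kim's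
dictionary, at the exponent `k + 1 ≤ v₃(c_ℓ)`, every reduction type at `ℓ`.
[cite: Buyukboduk2009TamagawaDefect, Thm. 3.1 and Cor. 3.3] [cite: MazurRubin2004, Prop. 6.2.6 and App. A Remark A.5]
[cite: Kim2022StructureSelmer, Thm. 3.13 (arXiv p. 17)] -/
theorem kuriharaNumber_eq_zero_of_witnessAt_blochKatoRelaxed_of_pow_succ_dvd_le
    [Finite (geomTorsion W ((3 : ℕ) : ℤ))] [Finite (geomTorsion W (((3 : ℕ) : ℤ) ^ 0 * ((3 : ℕ) : ℤ)))]
    {inv : LocalInvariants ℚ 3}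
    (hperf : inv.IsPerfect) (hsum : inv.SumLocalTermEqZero) (hcompl : inv.SelmerComplement)
    (hEP : ∀ v : HeightOneSpectrum (𝓞 ℚ), localEulerPoincareCharacteristic (v.adicCompletion ℚ))
    (T : Finset (HeightOneSpectrum (𝓞 ℚ)))
    (h3T : ∀ v : HeightOneSpectrum (𝓞 ℚ), ((3 : ℕ) : 𝓞 ℚ) ∈ v.asIdeal → v ∈ T)
    (hbadT : ∀ v : HeightOneSpectrum (𝓞 ℚ), ¬ W.HasGoodReductionAt v → v ∈ T)
    {ℓ : HeightOneSpectrum (𝓞 ℚ)} (h3ℓ : ((3 : ℕ) : 𝓞 ℚ) ∉ ℓ.asIdeal) (k : ℕ)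
    (hk : 3 ^ (k + 1) ∣ (W.baseChange (ℓ.adicCompletion ℚ)).localTamagawaNumber (ℓ.adicCompletionIntegers ℚ))
    (h0 : ∀ (j : ℕ) (Q : geomTorsion W (((3 : ℕ) : ℤ) ^ j * ((3 : ℕ) : ℤ))),
      (∀ σ : absoluteGaloisGroup ℚ,
        W.torsionGaloisModule (((3 : ℕ) : ℤ) ^ j * ((3 : ℕ) : ℤ)) σ Q = Q) → Q = 0)
    {Sset : Set (HeightOneSpectrum (𝓞 ℚ))} {τ : absoluteGaloisGroup ℚ}
    (hτ : ∀ j : ℕ, Nonempty (cokerSubOne (W.torsionGaloisModule (((3 : ℕ) : ℤ) ^ j * ((3 : ℕ) : ℤ))) τ ≃+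
      ZMod (3 ^ (j + 1))))
    (hτ₁ : Nonempty (cokerSubOne (W.torsionGaloisModule ((3 : ℕ) : ℤ)) τ ≃+ ZMod 3))
    (hτμ : τ ∈ rootsOfUnityFixer ℚ (3 ^ (k + 1)))
    (D : (j : ℕ) → KolyvaginDatum (W.torsionGaloisModule (((3 : ℕ) : ℤ) ^ j * ((3 : ℕ) : ℤ))))
    {P : Set (HeightOneSpectrum (𝓞 ℚ))} (hP : ∀ j, (D j).primes = P) (hPT : ∀ q ∈ P, q ∉ T)
    (hPc : P ⊆ frobeniusClassPrimes
      (W.torsionGaloisModule (((3 : ℕ) : ℤ) ^ k * ((3 : ℕ) : ℤ))) Sset τ (3 ^ (k + 1)))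
    (hT : ∀ j, (D j).transverse = cyclotomicTransverse _)
    {η : (q : HeightOneSpectrum (𝓞 ℚ)) → (ZMod (Ideal.absNorm q.asIdeal))ˣ}
    (hD : ∀ j, j ≤ k → (D j).HasCanonicalComparison (3 ^ (j + 1)) η) (hadm : ∀ j, j ≤ k → (D j).IsAdmissible)
    (hprime : ∀ c : galoisCohomology (W.torsionGaloisModule (((3 : ℕ) : ℤ) ^ 0 * ((3 : ℕ) : ℤ))) 1, c ≠ 0 →
      ∀ c' : galoisCohomology (DiscreteGaloisModule.tateDual
        (W.torsionGaloisModule (((3 : ℕ) : ℤ) ^ 0 * ((3 : ℕ) : ℤ))) 3) 1, c' ≠ 0 →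
      {q ∈ (D 0).primes |
        galoisCohomology.localization (W.torsionGaloisModule (((3 : ℕ) : ℤ) ^ 0 * ((3 : ℕ) : ℤ)))
          (Sum.inr q) 1 c ≠ 0 ∧
        galoisCohomology.localization (DiscreteGaloisModule.tateDual
          (W.torsionGaloisModule (((3 : ℕ) : ℤ) ^ 0 * ((3 : ℕ) : ℤ))) 3) (Sum.inr q) 1 c' ≠ 0}.Infinite)
    -- the PORT″ witness at depth `k` on the datum `D k`, with its Kolyvagin system in `𝓕_u`
    {v₃ : HeightOneSpectrum (𝓞 ℚ)} {N : ℕ} [NeZero N] {P₀ : ModularParametrizationData W N}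
    {κ : Finset (HeightOneSpectrum (𝓞 ℚ)) →
      galoisCohomology (W.torsionGaloisModule (((3 : ℕ) : ℤ) ^ k * ((3 : ℕ) : ℤ))) 1}
    {Λ : galoisCohomology ((W.torsionGaloisModule (((3 : ℕ) : ℤ) ^ k * ((3 : ℕ) : ℤ))).toLocal
      (Sum.inr v₃)) 1 →+ ZMod (3 ^ (k + 1))}
    {κ' : Finset (HeightOneSpectrum (𝓞 ℚ)) →
      galoisCohomology (W.torsionGaloisModule (((3 : ℕ) : ℤ) ^ k * ((3 : ℕ) : ℤ))) 1}
    (hW : KatoKuriharaWitnessAt W k 0 (D k) v₃ P₀ κ Λ κ')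
    (hκ'u : κ' ∈ (D k).kolyvaginSystems (blochKatoSelmerStructure 3 (tateTorsionDatum W 3 k) (fun _ _ => ⊤)))
    {d : Finset (HeightOneSpectrum (𝓞 ℚ))} (hd : (D k).IsLevel d) :
    ∃ ψ : (ℓ : ℕ) → (ZMod ℓ)ˣ →* Multiplicative (ZMod (3 ^ (k + 1))),
      (∀ q ∈ d, Function.Surjective (ψ (Ideal.absNorm q.asIdeal))) ∧
      haveI : NeZero (∏ q ∈ d, Ideal.absNorm q.asIdeal) :=
        ⟨Finset.prod_ne_zero_iff.2 fun q _ h => q.ne_bot (Ideal.absNorm_eq_zero_iff.1 h)⟩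
      kuriharaNumber P₀.f (3 ^ (k + 1)) (∏ q ∈ d, Ideal.absNorm q.asIdeal) ψ = 0 :=
  kuriharaNumber_eq_zero_of_witnessAt_of_mem_kolyvaginSystems_eq_bot W hW hκ'u
    (kolyvaginSystems_blochKatoRelaxed_eq_bot_of_pow_succ_dvd_le W hperf hsum hcompl hEP T h3T hbadT h3ℓ k hk
      h0 hτ hτ₁ hτμ D hP hPT hPc hT hD hadm hprime) hd


/-! ### §2 The deep bound, consumer form -/


/-- **«TamDiv∞» in Kurihara currency — the DEEP bound.**  For `W/ℚ` with the `3`-adic tower onto and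
`3^{m+1} ∣ c_ℓ` at one finite `ℓ ∤ 3` (any reduction type at `ℓ`), GRANTED part XV's binders (with the
data `D j` pinned on Sakamoto's class of `τ` through `E[3^m·3]` off a set `Sset ⊆ {bad} ∪ {3}`) and, at
every depth `k ≤ m`, a PORT″ witness on `D k` whose Kolyvagin system lies in `KS(E[3^k·3], 𝓕_u, D k)`:
**`(m + 1 : ℕ∞) ≤ kuriharaPartialDeepInfty W 3 P₀.f`** (module docstring §2).
[cite: Buyukboduk2009TamagawaDefect, Thm. 3.1 and Cor. 3.3] [cite: MazurRubin2004, Thm. 5.2.12 (i), Prop. 6.2.6 and App. A Remark A.5]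
[cite: Kim2022StructureSelmer, §1.2.2, Thm. 3.13 and Conj. 1.10 (PDF p. 8)] [cite: Sakamoto2024, §2 (pp. 920–921) and Def. 4.1] -/
theorem natCast_le_kuriharaPartialDeepInfty_of_witnesses_of_pow_succ_dvd_le
    [Finite (geomTorsion W ((3 : ℕ) : ℤ))] [Finite (geomTorsion W (((3 : ℕ) : ℤ) ^ 0 * ((3 : ℕ) : ℤ)))]
    (htower : ∀ n : ℕ, W.HasSurjectiveModNGaloisRep (3 ^ n : ℕ))
    {inv : LocalInvariants ℚ 3}
    (hperf : inv.IsPerfect) (hsum : inv.SumLocalTermEqZero) (hcompl : inv.SelmerComplement)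
    (hEP : ∀ v : HeightOneSpectrum (𝓞 ℚ), localEulerPoincareCharacteristic (v.adicCompletion ℚ))
    (T : Finset (HeightOneSpectrum (𝓞 ℚ)))
    (h3T : ∀ v : HeightOneSpectrum (𝓞 ℚ), ((3 : ℕ) : 𝓞 ℚ) ∈ v.asIdeal → v ∈ T)
    (hbadT : ∀ v : HeightOneSpectrum (𝓞 ℚ), ¬ W.HasGoodReductionAt v → v ∈ T)
    {ℓ : HeightOneSpectrum (𝓞 ℚ)} (h3ℓ : ((3 : ℕ) : 𝓞 ℚ) ∉ ℓ.asIdeal) (m : ℕ)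
    (hm : 3 ^ (m + 1) ∣ (W.baseChange (ℓ.adicCompletion ℚ)).localTamagawaNumber (ℓ.adicCompletionIntegers ℚ))
    (h0 : ∀ (j : ℕ) (Q : geomTorsion W (((3 : ℕ) : ℤ) ^ j * ((3 : ℕ) : ℤ))),
      (∀ σ : absoluteGaloisGroup ℚ,
        W.torsionGaloisModule (((3 : ℕ) : ℤ) ^ j * ((3 : ℕ) : ℤ)) σ Q = Q) → Q = 0)
    {Sset : Set (HeightOneSpectrum (𝓞 ℚ))}
    (hSset : ∀ v ∈ Sset, ¬ W.HasGoodReductionAt v ∨ ((3 : ℕ) : 𝓞 ℚ) ∈ v.asIdeal)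
    {τ : absoluteGaloisGroup ℚ}
    (hτ : ∀ j : ℕ, Nonempty (cokerSubOne (W.torsionGaloisModule (((3 : ℕ) : ℤ) ^ j * ((3 : ℕ) : ℤ))) τ ≃+
      ZMod (3 ^ (j + 1))))
    (hτ₁ : Nonempty (cokerSubOne (W.torsionGaloisModule ((3 : ℕ) : ℤ)) τ ≃+ ZMod 3))
    (hτμ : τ ∈ rootsOfUnityFixer ℚ (3 ^ (m + 1)))
    (D : (j : ℕ) → KolyvaginDatum (W.torsionGaloisModule (((3 : ℕ) : ℤ) ^ j * ((3 : ℕ) : ℤ))))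
    (hP : ∀ j, (D j).primes = frobeniusClassPrimes
      (W.torsionGaloisModule (((3 : ℕ) : ℤ) ^ m * ((3 : ℕ) : ℤ))) Sset τ (3 ^ (m + 1)))
    (hPT : ∀ q ∈ frobeniusClassPrimes
      (W.torsionGaloisModule (((3 : ℕ) : ℤ) ^ m * ((3 : ℕ) : ℤ))) Sset τ (3 ^ (m + 1)), q ∉ T)
    (hT : ∀ j, (D j).transverse = cyclotomicTransverse _)
    {η : (q : HeightOneSpectrum (𝓞 ℚ)) → (ZMod (Ideal.absNorm q.asIdeal))ˣ}
    (hD : ∀ j, j ≤ m → (D j).HasCanonicalComparison (3 ^ (j + 1)) η) (hadm : ∀ j, j ≤ m → (D j).IsAdmissible)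
    (hprime : ∀ c : galoisCohomology (W.torsionGaloisModule (((3 : ℕ) : ℤ) ^ 0 * ((3 : ℕ) : ℤ))) 1, c ≠ 0 →
      ∀ c' : galoisCohomology (DiscreteGaloisModule.tateDual
        (W.torsionGaloisModule (((3 : ℕ) : ℤ) ^ 0 * ((3 : ℕ) : ℤ))) 3) 1, c' ≠ 0 →
      {q ∈ (D 0).primes |
        galoisCohomology.localization (W.torsionGaloisModule (((3 : ℕ) : ℤ) ^ 0 * ((3 : ℕ) : ℤ)))
          (Sum.inr q) 1 c ≠ 0 ∧
        galoisCohomology.localization (DiscreteGaloisModule.tateDual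
          (W.torsionGaloisModule (((3 : ℕ) : ℤ) ^ 0 * ((3 : ℕ) : ℤ))) 3) (Sum.inr q) 1 c' ≠ 0}.Infinite)
    -- the displayed PORT: a 𝓕_u-witness at every depth `k ≤ m` on the datum `D k`
    {v₃ : HeightOneSpectrum (𝓞 ℚ)} {N : ℕ} [NeZero N] (P₀ : ModularParametrizationData W N)
    (hwit : ∀ k, k ≤ m →
      ∃ (κ : Finset (HeightOneSpectrum (𝓞 ℚ)) →
            galoisCohomology (W.torsionGaloisModule (((3 : ℕ) : ℤ) ^ k * ((3 : ℕ) : ℤ))) 1)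
        (Λ : galoisCohomology ((W.torsionGaloisModule (((3 : ℕ) : ℤ) ^ k * ((3 : ℕ) : ℤ))).toLocal
            (Sum.inr v₃)) 1 →+ ZMod (3 ^ (k + 1)))
        (κ' : Finset (HeightOneSpectrum (𝓞 ℚ)) →
            galoisCohomology (W.torsionGaloisModule (((3 : ℕ) : ℤ) ^ k * ((3 : ℕ) : ℤ))) 1),
        KatoKuriharaWitnessAt W k 0 (D k) v₃ P₀ κ Λ κ' ∧
          κ' ∈ (D k).kolyvaginSystems
            (blochKatoSelmerStructure 3 (tateTorsionDatum W 3 k) (fun _ _ => ⊤))) :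
    ((m + 1 : ℕ) : ℕ∞) ≤ kuriharaPartialDeepInfty W 3 P₀.f := by
  haveI : Fact (Nat.Prime 3) := ⟨Nat.prime_three⟩
  have hsurjK : ∀ k, W.HasSurjectiveModNGaloisRep (((3 : ℕ) : ℤ) ^ k * ((3 : ℕ) : ℤ)) :=
    hasSurjectiveModNGaloisRep_pow_mul_of_tower W htower
  have hτμk : ∀ k, k ≤ m → τ ∈ rootsOfUnityFixer ℚ (3 ^ (k + 1)) := fun k hk =>
    rootsOfUnityFixer_le_of_dvd ℚ (pow_dvd_pow 3 (Nat.succ_le_succ hk)) hτμ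
  -- the pinned class lies in every shallower class
  have hPc : ∀ k, k ≤ m → frobeniusClassPrimes
      (W.torsionGaloisModule (((3 : ℕ) : ℤ) ^ m * ((3 : ℕ) : ℤ))) Sset τ (3 ^ (m + 1)) ⊆
      frobeniusClassPrimes (W.torsionGaloisModule (((3 : ℕ) : ℤ) ^ k * ((3 : ℕ) : ℤ))) Sset τ (3 ^ (k + 1)) :=
    fun k hk => FrobShape.frobeniusClassPrimes_pow_mul_subset_of_le W 3 hk (hsurjK k) (hτμk k hk) (hτ k)
      hτμ (hτ m) Sset
  refine le_kuriharaPartialDeepInfty_of_forall_level_forall_depth W 3 P₀.f (m + 1)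
    fun n hn hmn k hk => ?_
  have hkm : k ≤ m := Nat.lt_succ_iff.mp hk
  -- the places of `n` form a level of the pinned data (bridge (B1))
  obtain ⟨nF, hnF, hprod, hmem⟩ := FrobShape.exists_level_of_kolyvaginProduct W 3 (Nat.succ_pos m) hmn
    (fun v hv => natCard_torsionBy_reductionAt_le_of_dvd W 3 (fun ℓ' _ hℓ' => hn.2 ℓ' hℓ') hv)
    (((3 : ℕ) : ℤ) ^ m * ((3 : ℕ) : ℤ)) (by push_cast; exact (pow_succ _ _).symm) (hsurjK m) hτμ (hτ m)
    (S := Sset) (fun v hv hvS => by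
      obtain ⟨hgood, h3⟩ := hasGoodReductionAt_and_not_mem_of_kolyvaginProduct W 3 hmn hv
      rcases hSset v hvS with hbad | h3v
      · exact hbad hgood
      · exact h3 h3v)
  have hd : (D k).IsLevel nF := by
    show (↑nF : Set (HeightOneSpectrum (𝓞 ℚ))) ⊆ (D k).primes
    rw [hP k]
    exact hnF
  -- part XV at depth `k` (`3^{k+1} ∣ 3^{m+1} ∣ c_ℓ`) through part XXII §4
  have hk' : 3 ^ (k + 1) ∣ (W.baseChange (ℓ.adicCompletion ℚ)).localTamagawaNumber
      (ℓ.adicCompletionIntegers ℚ) := (pow_dvd_pow 3 (Nat.succ_le_succ hkm)).trans hm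
  haveI : NeZero n := ⟨hmn.ne_zero⟩
  obtain ⟨κ, Λ, κ', hW, hκ'u⟩ := hwit k hkm
  obtain ⟨ψ, hψ, h0ψ⟩ := kuriharaNumber_eq_zero_of_witnessAt_blochKatoRelaxed_of_pow_succ_dvd_le W hperf hsum
    hcompl hEP T h3T hbadT h3ℓ k hk' h0 hτ hτ₁ (hτμk k hkm) D hP (fun q hq => hPT q hq) (hPc k hkm) hT
    (fun j hj => hD j (hj.trans hkm)) (fun j hj => hadm j (hj.trans hkm)) hprime hW hκ'u hd
  exact ⟨ψ, exists_surjective_kuriharaNumber_eq_zero_of_prod_eq P₀.f _ hprod hmem hψ h0ψ⟩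

/-! ### §3 The exponent read as `v₃(c_ℓ)`: the (TD) binder on rows with ONE Tamagawa-`3` prime -/

/-- **`(v₃(c_ℓ) : ℕ∞) ≤ ∂^{(∞)}_{deep}(δ̃)`** — §2 at `m + 1 = v₃(c_ℓ)` (`3^{v₃(c_ℓ)} ∣ c_ℓ`,
`pow_padicValNat_dvd`; the binder `hmv` names the depth `m` at which the data are pinned): the corner
road's (TD) binder `hTD` of crux 19679
(`KimAtThreeDeepLowerOffStratumCornerKeysSharp.stub_nonAdditive_of_sharpCornerLowerHalves_of_tamagawa_le_deepInfty`,
`(v₃ ∏ c_ℓ : ℕ∞) ≤ kuriharaPartialDeepInfty W 3 f`) on the rows where ONE bad prime `ℓ ≠ 3` has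
`3 ∣ c_ℓ` (there `v₃(∏ c_ℓ) = v₃(c_ℓ)`), GRANTED part XV's binders and the displayed `𝓕_u`-witnesses.
On rows with two Tamagawa-`3` primes the product exponent is NOT available from this road (part XVII).
[cite: Buyukboduk2009TamagawaDefect, Thm. 3.1, Cor. 3.3 and §4.2 (Question 1)]
[cite: Kim2022StructureSelmer, Conj. 1.10 (PDF p. 8)] [cite: MazurRubin2004, App. A Remark A.5] -/
theorem natCast_padicValNat_le_kuriharaPartialDeepInfty_of_witnesses_le
    [Finite (geomTorsion W ((3 : ℕ) : ℤ))] [Finite (geomTorsion W (((3 : ℕ) : ℤ) ^ 0 * ((3 : ℕ) : ℤ)))]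
    (htower : ∀ n : ℕ, W.HasSurjectiveModNGaloisRep (3 ^ n : ℕ))
    {inv : LocalInvariants ℚ 3}
    (hperf : inv.IsPerfect) (hsum : inv.SumLocalTermEqZero) (hcompl : inv.SelmerComplement)
    (hEP : ∀ v : HeightOneSpectrum (𝓞 ℚ), localEulerPoincareCharacteristic (v.adicCompletion ℚ))
    (T : Finset (HeightOneSpectrum (𝓞 ℚ)))
    (h3T : ∀ v : HeightOneSpectrum (𝓞 ℚ), ((3 : ℕ) : 𝓞 ℚ) ∈ v.asIdeal → v ∈ T)
    (hbadT : ∀ v : HeightOneSpectrum (𝓞 ℚ), ¬ W.HasGoodReductionAt v → v ∈ T)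
    {ℓ : HeightOneSpectrum (𝓞 ℚ)} (h3ℓ : ((3 : ℕ) : 𝓞 ℚ) ∉ ℓ.asIdeal) (m : ℕ)
    (hmv : padicValNat 3 ((W.baseChange (ℓ.adicCompletion ℚ)).localTamagawaNumber
      (ℓ.adicCompletionIntegers ℚ)) = m + 1)
    (h0 : ∀ (j : ℕ) (Q : geomTorsion W (((3 : ℕ) : ℤ) ^ j * ((3 : ℕ) : ℤ))),
      (∀ σ : absoluteGaloisGroup ℚ,
        W.torsionGaloisModule (((3 : ℕ) : ℤ) ^ j * ((3 : ℕ) : ℤ)) σ Q = Q) → Q = 0)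
    {Sset : Set (HeightOneSpectrum (𝓞 ℚ))}
    (hSset : ∀ v ∈ Sset, ¬ W.HasGoodReductionAt v ∨ ((3 : ℕ) : 𝓞 ℚ) ∈ v.asIdeal)
    {τ : absoluteGaloisGroup ℚ}
    (hτ : ∀ j : ℕ, Nonempty (cokerSubOne (W.torsionGaloisModule (((3 : ℕ) : ℤ) ^ j * ((3 : ℕ) : ℤ))) τ ≃+
      ZMod (3 ^ (j + 1))))
    (hτ₁ : Nonempty (cokerSubOne (W.torsionGaloisModule ((3 : ℕ) : ℤ)) τ ≃+ ZMod 3))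
    (hτμ : τ ∈ rootsOfUnityFixer ℚ (3 ^ (m + 1)))
    (D : (j : ℕ) → KolyvaginDatum (W.torsionGaloisModule (((3 : ℕ) : ℤ) ^ j * ((3 : ℕ) : ℤ))))
    (hP : ∀ j, (D j).primes = frobeniusClassPrimes
      (W.torsionGaloisModule (((3 : ℕ) : ℤ) ^ m * ((3 : ℕ) : ℤ))) Sset τ (3 ^ (m + 1)))
    (hPT : ∀ q ∈ frobeniusClassPrimes
      (W.torsionGaloisModule (((3 : ℕ) : ℤ) ^ m * ((3 : ℕ) : ℤ))) Sset τ (3 ^ (m + 1)), q ∉ T)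
    (hT : ∀ j, (D j).transverse = cyclotomicTransverse _)
    {η : (q : HeightOneSpectrum (𝓞 ℚ)) → (ZMod (Ideal.absNorm q.asIdeal))ˣ}
    (hD : ∀ j, j ≤ m → (D j).HasCanonicalComparison (3 ^ (j + 1)) η) (hadm : ∀ j, j ≤ m → (D j).IsAdmissible)
    (hprime : ∀ c : galoisCohomology (W.torsionGaloisModule (((3 : ℕ) : ℤ) ^ 0 * ((3 : ℕ) : ℤ))) 1, c ≠ 0 →
      ∀ c' : galoisCohomology (DiscreteGaloisModule.tateDual
        (W.torsionGaloisModule (((3 : ℕ) : ℤ) ^ 0 * ((3 : ℕ) : ℤ))) 3) 1, c' ≠ 0 →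
      {q ∈ (D 0).primes |
        galoisCohomology.localization (W.torsionGaloisModule (((3 : ℕ) : ℤ) ^ 0 * ((3 : ℕ) : ℤ)))
          (Sum.inr q) 1 c ≠ 0 ∧
        galoisCohomology.localization (DiscreteGaloisModule.tateDual
          (W.torsionGaloisModule (((3 : ℕ) : ℤ) ^ 0 * ((3 : ℕ) : ℤ))) 3) (Sum.inr q) 1 c' ≠ 0}.Infinite)
    {v₃ : HeightOneSpectrum (𝓞 ℚ)} {N : ℕ} [NeZero N] (P₀ : ModularParametrizationData W N)
    (hwit : ∀ k, k ≤ m →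
      ∃ (κ : Finset (HeightOneSpectrum (𝓞 ℚ)) →
            galoisCohomology (W.torsionGaloisModule (((3 : ℕ) : ℤ) ^ k * ((3 : ℕ) : ℤ))) 1)
        (Λ : galoisCohomology ((W.torsionGaloisModule (((3 : ℕ) : ℤ) ^ k * ((3 : ℕ) : ℤ))).toLocal
            (Sum.inr v₃)) 1 →+ ZMod (3 ^ (k + 1)))
        (κ' : Finset (HeightOneSpectrum (𝓞 ℚ)) →
            galoisCohomology (W.torsionGaloisModule (((3 : ℕ) : ℤ) ^ k * ((3 : ℕ) : ℤ))) 1),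
        KatoKuriharaWitnessAt W k 0 (D k) v₃ P₀ κ Λ κ' ∧
          κ' ∈ (D k).kolyvaginSystems
            (blochKatoSelmerStructure 3 (tateTorsionDatum W 3 k) (fun _ _ => ⊤))) :
    ((padicValNat 3 ((W.baseChange (ℓ.adicCompletion ℚ)).localTamagawaNumber
        (ℓ.adicCompletionIntegers ℚ)) : ℕ) : ℕ∞) ≤ kuriharaPartialDeepInfty W 3 P₀.f := by
  have hdvd : 3 ^ (m + 1) ∣ (W.baseChange (ℓ.adicCompletion ℚ)).localTamagawaNumber
      (ℓ.adicCompletionIntegers ℚ) := hmv ▸ pow_padicValNat_dvd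
  rw [hmv]
  exact natCast_le_kuriharaPartialDeepInfty_of_witnesses_of_pow_succ_dvd_le W htower hperf hsum hcompl hEP T h3T
    hbadT h3ℓ m hdvd h0 hSset hτ hτ₁ hτμ D hP hPT hT hD hadm hprime P₀ hwit

end Three

end Summit.BirchSwinnertonDyer.BirchSwinnertonDyer.Theorems.KimAtThreeD7uTamagawaKuriharaDeepLe

end
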